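import Summits.ResolutionOfSingularities.ResolutionOfSingularities.Theorems.PurelyInseparableDim4ChartZigzagStep
import Summits.ResolutionOfSingularities.ResolutionOfSingularities.Theorems.PurelyInseparableDim4CoordinateSNCTranslated
import Literature.AlgebraicGeometry.Resolution.BlowupSequencesBoundarySuperset
import HarnessLib

/-!
# Purely inseparable four-folds `z^p + F(x₁, …, x₄)`: the BOUNDARY through a zigzag chart — strict transforms
# transport along the comparison isomorphism, and the translated shape gives the FC-1 input on the zigzag piece
# (brick (c) 3b⁺ of cell `res-dim4-pi`, typ-2 g3 for typ-3 g3's joint point∘coordinate tree)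

[OURS · counted 0] (D-0157 DOOR 2; director-resolution DR-157-C; desk WORD #66 (4)(c) / #70 (c)). Sequel of
`PurelyInseparableDim4ChartZigzagStep.lean`. typ-3 g3's configuration invariant for a COORDINATE member carries the
FC-1 input `HasSNCWith (M'.boundary.map (·.comap φ)) ((𝓘Λ S).comap ψ)` on the zigzag piece `Y`; to re-establish it
for the NEW members after a step one needs (i) the readings of the strict transforms of the old boundary members on
the new zigzag chart and (ii) «translated shape ⇒ snc» on `Y`. PROVED here (no `sorry`, no new axiom):

* **`zigzag_transport_strictTransform`** — along the comparison `ε : π⁻¹ φ(Y) ≅ B⁻¹ ψ(Y)` of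
  `exists_iso_restrict_blowup_zigzag` (square `hsq`, centre identity `hC'`), the strict transform under `π` of a
  member `D` reading `φ^* D = ψ^* D₀` is `ε^*` of the strict transform of `D₀` under the MODEL `B`
  (GW (13.19): strict transforms commute with flat base change) — so with `zigzag_transport_comap` every old
  member's strict transform reads, on the zigzag chart of the chart, what typ-2's depth-one boundary dictionary
  (`comap_hyperplane_chart`, `comap_translate_hyperplane_chart`, `comap_hyperplane_self_chart`) says for the model;
* **`hasSNCWith_comap_of_shapeT_zigzag`** — TRANSLATED SHAPE ⇒ FC-1 INPUT ON THE ZIGZAG PIECE: if `E` has snc on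
  `Z` (locally Noetherian) and every member of `E` meeting `φ(ψ⁻¹ V(x_Λ'))` reads `ψ^* V(x_{idx} + cst)` on `Y` with
  `cst = 0` when `idx ∈ S'` and `idx` injective on those members, then
  `HasSNCWith (E.map (·.comap φ)) ((𝓘Λ Λ').comap ψ)` (`Λ' = {z} ∪ x_{S'}`) — g2's
  `hasSNCWith_globalCentre_of_shapeT` in zigzag dress (one translation straightens the meeting members on `𝔸⁵`,
  `hasSNCWith_translatedHyperplanes_𝓘Λ`, pulled back along `ψ`; the others miss the centre,
  `HasSNCWith.of_disjoint`). With `hasSNCWith_globalCentre_zigzag` (3a) this gives snc with the global centre.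

Nothing here is a statement about resolution of singularities in dimension ≥ 4 / characteristic `p` (NOT proved
anywhere in this programme). bears_on: LADDER-RESOLUTION:D157-DOOR2 (res-dim4-pi). Supports
stmt-ResolutionOfSingularities-16155 (helper, (c) 3b⁺).
-/

-- every declaration of this summit lives under `Summit.ResolutionOfSingularities.ResolutionOfSingularities`
-- (summit = problem), which the duplicate-namespace linter flags; house convention (cf. the Target file).
set_option linter.dupNamespace false

noncomputable section

open MvPolynomial Finset CategoryTheory CategoryTheory.Limits AlgebraicGeometry Opposite TopologicalSpace
open AlgebraicGeometry.Scheme.IdealSheafData (ofIdealTop vanishingIdeal)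

namespace Summit.ResolutionOfSingularities.ResolutionOfSingularities.Theorems.PIDim4

open Literature.AlgebraicGeometry.Resolution
open Literature.AlgebraicGeometry.Resolution.AffinePointBlowup (P A γ coord Wtop)

namespace ChartDictionary

/-! ## §1 Strict transforms transport along the comparison isomorphism -/

section StrictTransport

variable {K : Type} [Field K] {Z Y W Bl : Scheme.{0}} (φ : Y ⟶ Z) [IsOpenImmersion φ] (ψ : Y ⟶ P 4 K)
  [IsOpenImmersion ψ] {π : W ⟶ Z} {B : Bl ⟶ P 4 K}
  (ε : (π ⁻¹ᵁ φ.opensRange : Scheme.{0}) ≅ (B ⁻¹ᵁ ψ.opensRange : Scheme.{0}))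

/-- **Strict transforms transport along `ε`**: for a member `D` of the boundary on `Z` reading `φ^* D = ψ^* D₀`,
`ε^* ((σˢ_{B, 𝓘Λ} D₀)|_{B⁻¹ ψ(Y)}) = (σˢ_{π, Zc} D)|_{π⁻¹ φ(Y)}` (GW (13.19), flat base change). -/
theorem zigzag_transport_strictTransform [IsLocallyNoetherian W] [IsLocallyNoetherian Bl] (Λ' : Set (Fin (4 + 1)))
    (Zc : Z.IdealSheafData)
    (hsq : ε.hom ≫ (B ∣_ ψ.opensRange) = (π ∣_ φ.opensRange) ≫ (φ.isoOpensRange.inv ≫ ψ.isoOpensRange.hom))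
    (hC' : ((AffineCoordBlowup.𝓘Λ 4 K Λ').comap ψ.opensRange.ι).comap (φ.isoOpensRange.inv ≫ ψ.isoOpensRange.hom) =
      Zc.comap φ.opensRange.ι)
    (D : Z.IdealSheafData) (D₀ : (P 4 K).IdealSheafData) (hD : D.comap φ = D₀.comap ψ) :
    ((strictTransformIdeal B (AffineCoordBlowup.𝓘Λ 4 K Λ') D₀).comap (B ⁻¹ᵁ ψ.opensRange).ι).comap ε.hom =
      (strictTransformIdeal π Zc D).comap (π ⁻¹ᵁ φ.opensRange).ι := by
  have he₁ι : φ.isoOpensRange.hom ≫ φ.opensRange.ι = φ := Scheme.Hom.isoOpensRange_hom_ι φ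
  have he₂ι : ψ.isoOpensRange.hom ≫ ψ.opensRange.ι = ψ := Scheme.Hom.isoOpensRange_hom_ι ψ
  have hDV : (D.comap φ.opensRange.ι).comap φ.isoOpensRange.hom = D₀.comap ψ := by
    rw [← Scheme.IdealSheafData.comap_comp, he₁ι]
    exact hD
  have hDU : (D₀.comap ψ.opensRange.ι).comap ψ.isoOpensRange.hom = D₀.comap ψ := by
    rw [← Scheme.IdealSheafData.comap_comp, he₂ι]
  have hD' : (D₀.comap ψ.opensRange.ι).comap (φ.isoOpensRange.inv ≫ ψ.isoOpensRange.hom) =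
      D.comap φ.opensRange.ι := by
    rw [Scheme.IdealSheafData.comap_comp, hDU, ← hDV, ← Scheme.IdealSheafData.comap_comp, Iso.inv_hom_id,
      Scheme.IdealSheafData.comap_id]
  rw [← strictTransformIdeal_morphismRestrict, ← strictTransformIdeal_morphismRestrict,
    comap_strictTransformIdeal_of_flat (s := ε.hom) (π := B ∣_ ψ.opensRange) (π' := π ∣_ φ.opensRange)
      (φ.isoOpensRange.inv ≫ ψ.isoOpensRange.hom) hsq, hC', hD']

end StrictTransport

/-! ## §2 Translated shape ⇒ the FC-1 input on the zigzag piece -/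

section ShapeZigzag

variable {K : Type} [Field K] {Z Y : Scheme.{0}} (φ : Y ⟶ Z) [IsOpenImmersion φ] (ψ : Y ⟶ P 4 K)
  [IsOpenImmersion ψ] {S' : Finset (Fin 4)}

/-- **TRANSLATED SHAPE ⇒ FC-1 INPUT on the zigzag piece.** Let `E` have simple normal crossings on `Z`. Suppose
every member of `E` meeting `φ(ψ⁻¹ V(z, x_{S'}))` reads `ψ^* V(x_{idx D} + cst D)` on `Y`, with `cst D = 0` when
`idx D ∈ S'`, and `idx` is injective on those members. Then `φ^* E` has simple normal crossings with `ψ^* 𝓘Λ` on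
`Y`. -/
theorem hasSNCWith_comap_of_shapeT_zigzag [IsLocallyNoetherian Z] {E : List Z.IdealSheafData} (hE : HasSNC E)
    (idx : Z.IdealSheafData → Fin 4) (cst : Z.IdealSheafData → K)
    (hshape : ∀ D ∈ E,
      ((D.support : Set Z) ∩ φ '' (ψ ⁻¹'
        (AffineCoordBlowup.CΛ 4 K (insert 0 (Fin.succ '' (S' : Set (Fin 4)))) : Set (P 4 K)))).Nonempty →
      D.comap φ = (ofIdealTop (Ideal.span {(γ 4 K).symm (X (idx D).succ + C (cst D))})).comap ψ ∧
        (idx D ∈ S' → cst D = 0))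
    (hinj : ∀ D₁ ∈ E, ∀ D₂ ∈ E,
      ((D₁.support : Set Z) ∩ φ '' (ψ ⁻¹'
        (AffineCoordBlowup.CΛ 4 K (insert 0 (Fin.succ '' (S' : Set (Fin 4)))) : Set (P 4 K)))).Nonempty →
      ((D₂.support : Set Z) ∩ φ '' (ψ ⁻¹'
        (AffineCoordBlowup.CΛ 4 K (insert 0 (Fin.succ '' (S' : Set (Fin 4)))) : Set (P 4 K)))).Nonempty →
      idx D₁ = idx D₂ → D₁ = D₂) :
    HasSNCWith (E.map (·.comap φ))
      ((AffineCoordBlowup.𝓘Λ 4 K (insert 0 (Fin.succ '' (S' : Set (Fin 4))))).comap ψ) := by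
  classical
  haveI : IsLocallyNoetherian Y := LocallyOfFiniteType.isLocallyNoetherian φ
  -- the members meeting the centre
  set T : Set Z := φ '' (ψ ⁻¹'
    (AffineCoordBlowup.CΛ 4 K (insert 0 (Fin.succ '' (S' : Set (Fin 4)))) : Set (P 4 K))) with hT
  set M1 : Z.IdealSheafData → Prop := fun D => ((D.support : Set Z) ∩ T).Nonempty with hM1
  set E' := E.filter (fun D => decide (M1 D)) with hE'
  have hmemE' : ∀ D, D ∈ E' ↔ D ∈ E ∧ M1 D := by
    intro D; rw [hE', List.mem_filter, decide_eq_true_iff]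
  -- ONE translation vector for all of them
  let c : Fin (4 + 1) → K := Fin.cases 0 fun i => if h : ∃ D ∈ E', idx D = i then cst h.choose else 0
  have hc : ∀ D ∈ E', c (idx D).succ = cst D := by
    intro D hD
    have hex : ∃ D' ∈ E', idx D' = idx D := ⟨D, hD, rfl⟩
    simp only [c, Fin.cases_succ, dif_pos hex]
    obtain ⟨hD'mem, hD'idx⟩ := hex.choose_spec
    rw [hinj _ ((hmemE' _).mp hD'mem).1 D ((hmemE' _).mp hD).1 ((hmemE' _).mp hD'mem).2 ((hmemE' _).mp hD).2 hD'idx]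
  have hcΛ : ∀ k ∈ (insert 0 (Fin.succ '' (S' : Set (Fin 4))) : Set (Fin (4 + 1))), c k = 0 := by
    rintro k (rfl | ⟨i, hi, rfl⟩)
    · rfl
    · simp only [c, Fin.cases_succ]
      split_ifs with h
      · obtain ⟨hD'mem, hD'idx⟩ := h.choose_spec
        exact (hshape _ ((hmemE' _).mp hD'mem).1 ((hmemE' _).mp hD'mem).2).2 (hD'idx.symm ▸ hi)
      · rfl
  -- the meeting members read the `ψ`-pullbacks of ONE arrangement of translated hyperplanes
  have hmap : E'.map (·.comap φ) =
      ((E'.map fun D => (idx D).succ).map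
        (fun k => ofIdealTop (Ideal.span {(γ 4 K).symm (X k + C (c k))}))).map (·.comap ψ) := by
    rw [List.map_map, List.map_map]
    exact List.map_congr_left fun D hD => by
      rw [Function.comp_apply, Function.comp_apply, hc D hD]
      exact (hshape D ((hmemE' D).mp hD).1 ((hmemE' D).mp hD).2).1
  have hEc : HasSNCWith (E'.map (·.comap φ))
      ((AffineCoordBlowup.𝓘Λ 4 K (insert 0 (Fin.succ '' (S' : Set (Fin 4))))).comap ψ) := by
    rw [hmap]
    exact (hasSNCWith_translatedHyperplanes_𝓘Λ _ c _ hcΛ).comap_of_isOpenImmersion ψ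
  -- the whole restricted boundary has snc on `Y`
  have hEY : HasSNC (E.map (·.comap φ)) := by
    have h := hE.comap_of_isOpenImmersion φ
    rwa [Scheme.IdealSheafData.comap_top] at h
  refine HasSNCWith.of_disjoint hEc hEY fun DY hDY hDY' => ?_
  obtain ⟨D, hD, rfl⟩ := List.mem_map.mp hDY
  have hnot : ¬ M1 D := fun h => hDY' (List.mem_map.mpr ⟨D, (hmemE' D).mpr ⟨hD, h⟩, rfl⟩)
  rw [Scheme.IdealSheafData.support_comap, coe_support_comap_𝓘Λ ψ, Set.eq_empty_iff_forall_notMem]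
  rintro y ⟨hyD, hyC⟩
  exact hnot ⟨φ y, hyD, y, hyC, rfl⟩

end ShapeZigzag

end ChartDictionary

end Summit.ResolutionOfSingularities.ResolutionOfSingularities.Theorems.PIDim4

end
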